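import Literature.AlgebraicGeometry.Resolution.MarkedIdealsLemmas
import Literature.AlgebraicGeometry.Resolution.RegularCentreRsopPart
import Literature.AlgebraicGeometry.Resolution.MonomialMarkedIdeals
import HarnessLib

/-!
# A regular centre on a regular scheme is rsop-generated at its points; BGMW Lemma 3.2.1 (1) for
# regular centres («order-permissibility»: `V(C) ⊆ {ord ≥ μ}` with `V(C)` regular implies `𝓘 ⊆ 𝓘_C^μ`)

Topic: `Literature/AlgebraicGeometry/Resolution`. Bierstone–Grigoriev–Milman–Włodarczyk, *Effective
Hironaka resolution and its complexity* (arXiv:1206.3090), §3.2 Lemma 3.2.1 (1): «Let `C ⊂ supp(𝓘, μ)` be a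
smooth center … Then `𝓘 ⊂ 𝓘_C^μ`». The tree proves it (`le_pow_of_support_subset`,
`MarkedIdealsLemmas.lean`) reading «smooth centre» as the LOCAL condition `IsRsopGeneratedAt C x` — `C_x` is
generated by part of a regular system of parameters of the regular local ring `𝒪_{X,x}` (the shape supplied by a
simple-normal-crossings boundary, `HasSNCWith.isRsopGeneratedAt`). This file supplies that local condition from
the GLOBAL hypothesis the blow-up sequences of the tree carry — «`V(C)` is a regular scheme»
(`Scheme.IsRegular C.subscheme`, the centre clause of `IsRegularCentreBlowupSeq`, `IsBPermissibleSequenceB`,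
`IsMultipleBlowup`) — via Matsumura's Thm. 14.2 in the tree's `IsRsopPart` packaging
(`exists_isRsopPart_span_range_eq_stalkIdeal`, `RegularCentreRsopPart.lean`), and concludes Lemma 3.2.1 (1) for
regular centres on schemes with regular local rings along the centre:

* `isRsopGeneratedAt_of_isRsopPart_span_eq` — bridge `IsRsopPart c ∧ (c) = C_x ⇒ IsRsopGeneratedAt C x`
  (re-index the extension of `c` to a full regular system of parameters, `IsRsopPart.exists_rsop`);
* `isRsopGeneratedAt_of_isRegular_subscheme` — `V(C)` regular, `𝒪_{X,x}` regular, `x ∈ V(C)` ⇒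
  `IsRsopGeneratedAt C x`; `isRsopGeneratedAt_iff_of_isRegular` — on a scheme with regular local rings,
  `(∀ x ∈ V(C), IsRsopGeneratedAt C x) ↔ V(C) regular` (converse = `isRegular_subscheme_of_isRsopGeneratedAt`);
* `le_pow_of_isRegular_subscheme_of_forall_le_idealOrder` — **Lemma 3.2.1 (1) for a regular centre**: on a
  locally Noetherian scheme whose local rings at the points of `V(C)` are regular, if `V(C)` is regular and
  `μ ≤ ord_y 𝓘` at every point `y ∈ V(C)`, then `𝓘 ≤ C ^ μ` (ordinary = symbolic powers for such centres,
  `SymbolicPowersRsop.lean`, through the generic points of `V(C)`); `…_of_isRegular` — the same on a regular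
  scheme. This is the bridge from the literature's SUPPORT condition on centres (BGMW Def. 3.1.3 (1),
  Kollár 3.30.2) to the IDEAL-THEORETIC permissibility `𝓘 ≤ 𝓘_Z^μ` consumed by weighted controlled transforms.

Everything is PROVED; no definitions.

## Sources
* E. Bierstone, D. Grigoriev, P. Milman, J. Włodarczyk, arXiv:1206.3090, §3.1 Def. 3.1.3 (1)–(2), §3.2
  Lemma 3.2.1 (1). [BierstoneGrigorievMilmanWlodarczyk2011]
* H. Matsumura, *Commutative Ring Theory* (1986), Thm. 14.2 (regular quotients ⇔ part of a regular system of
  parameters), Thm. 16.2 (ii) (powers of such primes are primary). [Matsumura1987]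
* J. Kollár, *Lectures on Resolution of Singularities* (2007), 3.30.2 (order along a smooth centre). [Kollar2007]
-/

noncomputable section

open CategoryTheory AlgebraicGeometry TopologicalSpace IsLocalRing

namespace Literature.AlgebraicGeometry.Resolution

universe u

open Scheme.IdealSheafData

variable {X : Scheme.{u}}

/-! ## The bridge `IsRsopPart ⇒ IsRsopGeneratedAt` -/

/-- **Bridge between the two «part of a regular system of parameters» packagings of the tree**: if the stalk
`C_x` is generated by a family `c` which is part of a regular system of parameters of `𝒪_{X,x}` (`IsRsopPart`,
Matsumura §14), then `C` is rsop-generated at `x` in the sense of BGMW Def. 3.1.3 (2) (`IsRsopGeneratedAt`: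
`C_x = (u_i : i ∈ S)` for a minimal basis `u` of `𝔪_x` indexed by `Fin (emb dim)`). Proof: extend `c` to a full
regular system of parameters (`IsRsopPart.exists_rsop`) and re-index along `emb dim = r + e`.
[cite: BierstoneGrigorievMilmanWlodarczyk2011, Def. 3.1.3 (2)] [cite: Matsumura1987, Thm. 14.2] -/
theorem isRsopGeneratedAt_of_isRsopPart_span_eq {C : X.IdealSheafData} {x : X} {r : ℕ}
    {c : Fin r → X.presheaf.stalk x} (hc : IsRsopPart c)
    (hspan : Ideal.span (Set.range c) = stalkIdeal C x) : IsRsopGeneratedAt C x := by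
  obtain ⟨e, xs, hdim, hxs, hxc⟩ := hc.exists_rsop
  refine ⟨hc.isRegularLocalRing, fun j => xs (Fin.cast hdim j), ?_,
    Set.range (fun i : Fin r => Fin.cast hdim.symm (Fin.castAdd e i)), ?_⟩
  · -- the re-indexed family has the same range, hence spans `𝔪_x`
    have hr : Set.range (fun j => xs (Fin.cast hdim j)) = Set.range xs := by
      ext a
      constructor
      · rintro ⟨j, rfl⟩
        exact ⟨_, rfl⟩
      · rintro ⟨i, rfl⟩
        exact ⟨Fin.cast hdim.symm i, by simp⟩
    rw [hr, hxs]
  · -- `u '' S = range c`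
    rw [← hspan, ← Set.range_comp]
    congr 1
    ext a
    constructor
    · rintro ⟨i, rfl⟩
      exact ⟨i, by simp [hxc]⟩
    · rintro ⟨i, rfl⟩
      exact ⟨i, by simp [hxc]⟩

/-! ## Regular centres are rsop-generated at their points -/

/-- **A regular centre on a scheme with regular local ring at `x` is rsop-generated at `x`**: if `V(C)` is a
regular scheme, `𝒪_{X,x}` is regular and `x ∈ V(C)`, then `C_x` is generated by part of a regular system of
parameters of `𝒪_{X,x}` (Matsumura Thm. 14.2 through `exists_isRsopPart_span_range_eq_stalkIdeal`).
[cite: Matsumura1987, Thm. 14.2] [cite: BierstoneGrigorievMilmanWlodarczyk2011, Def. 3.1.3 (2)] -/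
theorem isRsopGeneratedAt_of_isRegular_subscheme [IsLocallyNoetherian X] {C : X.IdealSheafData}
    (hC : Scheme.IsRegular C.subscheme) {x : X} [IsRegularLocalRing (X.presheaf.stalk x)]
    (hx : x ∈ C.support) : IsRsopGeneratedAt C x := by
  obtain ⟨r, c, hc, hspan⟩ := exists_isRsopPart_span_range_eq_stalkIdeal hC hx
  exact isRsopGeneratedAt_of_isRsopPart_span_eq hc hspan

/-- **On a scheme with regular local rings, a centre is rsop-generated at all its points iff `V(C)` is a regular
scheme** (`⇐` above; `⇒` is `isRegular_subscheme_of_isRsopGeneratedAt`). [cite: Matsumura1987, Thm. 14.2] -/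
theorem isRsopGeneratedAt_iff_of_isRegular [IsLocallyNoetherian X] (hX : Scheme.IsRegular X)
    (C : X.IdealSheafData) :
    (∀ x ∈ C.support, IsRsopGeneratedAt C x) ↔ Scheme.IsRegular C.subscheme := by
  refine ⟨isRegular_subscheme_of_isRsopGeneratedAt, fun hC x hx => ?_⟩
  haveI : IsRegularLocalRing (X.presheaf.stalk x) := hX x
  exact isRsopGeneratedAt_of_isRegular_subscheme hC hx

/-! ## BGMW Lemma 3.2.1 (1) for regular centres («order-permissibility») -/

/-- **BGMW Lemma 3.2.1 (1) for a regular centre.** Let `X` be a locally Noetherian scheme, `C` an ideal sheaf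
with `V(C)` a REGULAR scheme and `𝒪_{X,x}` regular at every point `x ∈ V(C)`, and `𝓘` an ideal sheaf with
`μ ≤ ord_y 𝓘` at every point `y ∈ V(C)` (the centre lies in the order-`μ` locus `supp(𝓘, μ)`). Then
`𝓘 ≤ C ^ μ`. (At `x ∈ V(C)`, `C_x = P` is a prime generated by part of a regular system of parameters, so its
ordinary powers are `P`-primary and `𝓘_x ⊆ P^μ 𝒪_{X,η} ∩ 𝒪_{X,x} = P^{(μ)} = P^μ`, `η` the generic point of
the component of `V(C)` through `x`; off `V(C)` there is nothing to show — `le_pow_of_support_subset`.)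
[cite: BierstoneGrigorievMilmanWlodarczyk2011, Lemma 3.2.1 (1)] [cite: Matsumura1987, Thm. 16.2 (ii)]
[cite: Kollar2007, 3.30.2] -/
theorem le_pow_of_isRegular_subscheme_of_forall_le_idealOrder [IsLocallyNoetherian X]
    {I C : X.IdealSheafData} {μ : ℕ} (hC : Scheme.IsRegular C.subscheme)
    (hreg : ∀ x ∈ C.support, IsRegularLocalRing (X.presheaf.stalk x))
    (hsupp : ∀ y ∈ C.support, (μ : ℕ∞) ≤ idealOrder I y) : I ≤ C ^ μ := by
  refine le_pow_of_support_subset (fun x hx => ?_) hsupp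
  haveI : IsRegularLocalRing (X.presheaf.stalk x) := hreg x hx
  exact isRsopGeneratedAt_of_isRegular_subscheme hC hx

/-- **Order-permissibility on a regular scheme**: on a locally Noetherian REGULAR scheme, a centre `C` with
`V(C)` regular inside the order-`μ` locus of `𝓘` (`μ ≤ ord_y 𝓘` for all `y ∈ V(C)`) satisfies `𝓘 ≤ C ^ μ` —
the bridge from the support condition of the literature (BGMW Def. 3.1.3 (1); Kollár 3.30.2) to the
ideal-theoretic permissibility hypothesis `𝓘 ≤ 𝓘_Z^μ` of weighted controlled transforms.
[cite: BierstoneGrigorievMilmanWlodarczyk2011, Lemma 3.2.1 (1), Def. 3.1.3 (1)] [cite: Kollar2007, 3.30.2] -/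
theorem le_pow_of_isRegular_subscheme_of_forall_le_idealOrder_of_isRegular [IsLocallyNoetherian X]
    (hX : Scheme.IsRegular X) {I C : X.IdealSheafData} {μ : ℕ} (hC : Scheme.IsRegular C.subscheme)
    (hsupp : ∀ y ∈ C.support, (μ : ℕ∞) ≤ idealOrder I y) : I ≤ C ^ μ :=
  le_pow_of_isRegular_subscheme_of_forall_le_idealOrder hC (fun x _ => hX x) hsupp

end Literature.AlgebraicGeometry.Resolution

end
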